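import Literature.Geometry.Symplectic.SteinHandlebodies
import Literature.Geometry.Symplectic.SteinOneHandlebodies
import Literature.Geometry.Symplectic.SteinDomainDiffeomorph
import Literature.Geometry.Symplectic.SteinDomainComponents
import Literature.Topology.FourManifolds.OneHandlebodyClassification
import Literature.Topology.FourManifolds.SPC4HandlesLeaves
import Literature.Topology.FourManifolds.SPC4HandlesNormHolds
import Literature.Topology.FourManifolds.OneHandleStepExists
import Literature.Topology.FourManifolds.SpinProofs
import HarnessLib

/-!
# Eliashberg's theorem without `2`-handles, reduced to the classification of `1`-handlebodies

Topic `Literature/Geometry/Symplectic`; fact seat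
`provefact-Literature.Geometry.Symplectic.Gompf1998` for the named fact
`Literature.Geometry.Symplectic.Gompf1998_thm13_noTwoHandles` (`SteinHandlebodies.lean`; Gompf
1998, Thm. 1.3 with no `2`-handles; Akbulut–Matveyev 1998, Thm. 2 (1)): *every compact
orientable `4`-dimensional `1`-handlebody is a Stein domain*.  This file **proves that fact from
the classification of orientable `4`-dimensional `1`-handlebodies**, i.e. from the named facts
of `SPC4HandlesModelReduction.lean`

* NORM `Literature.Topology.FourManifolds.exists_hasHandleDecomposition_handleCount_one` — a
  compact connected `1`-handlebody has a handle decomposition with one `0`-handle and `k`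
  `1`-handles (Milnor's First Cancellation Theorem), and
* UNIQ₄ `Literature.Topology.FourManifolds.nonempty_diffeomorph_of_hasHandleDecomposition_handleCount_one`
  — two compact connected orientable `4`-manifolds with such decompositions for the same `k`
  are diffeomorphic (Kosinski VI (11.4)(c)), itself proved in
  `OneHandlebodyClassification.lean` from the handle facts L0
  (`zeroHandle_nonempty_diffeomorph_closedBall`) and L1 (`oneHandle_nonempty_diffeomorph`),

combined with the three proved ingredients of this topic:

* the models `{q(x, y) + z² + w² ≤ c} ⊂ ℂ²` of `♮ᵏ (S¹ × B³)` are Stein domains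
  (`isSteinDomain_fourThickening`, `SteinOneHandlebodies.lean`; Gompf 1998, §2);
* Stein domains are invariant under diffeomorphism (`IsSteinDomain.of_diffeomorph`,
  `SteinDomainDiffeomorph.lean`);
* a compact `4`-manifold whose components are Stein domains is a Stein domain, and components
  of a `1`-handlebody are `1`-handlebodies (`isSteinDomain_of_components`,
  `isHandlebodyOfIndexLE_opens`, `SteinDomainComponents.lean`; orientability of open
  submanifolds is `IsOrientable.opens`, `SpinProofs.lean`).

Results: `isSteinDomain_of_oneHandlebody_of_norm_uniq` (connected case),
`Gompf1998_thm13_noTwoHandles_of_norm_uniq : NORM → UNIQ₄ → Gompf1998_thm13_noTwoHandles`,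
`Gompf1998_thm13_noTwoHandles_of_handles : NORM → L0 → L1 → Gompf1998_thm13_noTwoHandles`, and,
NORM being discharged (`exists_hasHandleDecomposition_handleCount_one_holds`,
`SPC4HandlesNormHolds.lean`) and UNIQ₄ following from L1 alone
(`nonempty_diffeomorph_of_hasHandleDecomposition_handleCount_one_of_oneHandle`,
`SPC4HandlesLeaves.lean`), **`Gompf1998_thm13_noTwoHandles_of_oneHandle :
L1 → Gompf1998_thm13_noTwoHandles`**; L1 `oneHandle_nonempty_diffeomorph` (uniqueness of
attaching one `1`-handle) being discharged in turn (`oneHandle_nonempty_diffeomorph_holds`,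
`OneHandleStepExists.lean`), the file ends with the **discharge
`Gompf1998_thm13_noTwoHandles_holds : Gompf1998_thm13_noTwoHandles`**.

## References

* R. E. Gompf, *Handlebody construction of Stein surfaces*, Ann. of Math. 148 (1998), 619–693
  (arXiv:math/9803019), Thm. 1.3 and §2. [Gompf1998]
* S. Akbulut, R. Matveyev, *A convex decomposition theorem for 4-manifolds*, IMRN 1998, no. 7,
  371–381, Thm. 2 (1). [AkbulutMatveyev1998]
* A. A. Kosinski, *Differential Manifolds* (1993), VI (11.4)(c). [Kosinski1993]
* J. Milnor, *Lectures on the h-cobordism theorem* (1965), Thm. 5.4. [MilnorHCobordism1965]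
-/

noncomputable section

open scoped Manifold ContDiff Topology
open Set Function Filter TopologicalSpace

namespace Literature.Geometry.Symplectic

open Literature.Topology.FourManifolds

/-- **Eliashberg's theorem without `2`-handles, connected case, from NORM and UNIQ₄.**  A compact
connected orientable `4`-dimensional `1`-handlebody `V` is a Stein domain, granted the normal
form NORM (`exists_hasHandleDecomposition_handleCount_one`: one `0`-handle and `k` `1`-handles)
and the classification UNIQ₄ (`nonempty_diffeomorph_of_hasHandleDecomposition_handleCount_one`):
`V ≅ {q(x, y) + z² + w² ≤ c}`, the Stein model of genus `k` (`isSteinDomain_fourThickening`,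
`SteinOneHandlebodies.lean`), and Stein domains are invariant under diffeomorphism
(`IsSteinDomain.of_diffeomorph`, `SteinDomainDiffeomorph.lean`). Gompf (1998), Thm. 1.3 and §2;
Akbulut–Matveyev (1998), Thm. 2 (1). [cite: Gompf1998, Thm. 1.3] -/
theorem isSteinDomain_of_oneHandlebody_of_norm_uniq
    (hN : exists_hasHandleDecomposition_handleCount_one.{0})
    (hU : nonempty_diffeomorph_of_hasHandleDecomposition_handleCount_one.{0})
    (V : Type) [TopologicalSpace V] [T2Space V] [SecondCountableTopology V] [CompactSpace V]
    [ConnectedSpace V] [ChartedSpace (EuclideanHalfSpace 4) V] [IsManifold (𝓡∂ 4) ∞ V]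
    (ho : IsOrientable (𝓡∂ 4) V) (hV : IsHandlebodyOfIndexLE 3 1 V) : IsSteinDomain V := by
  obtain ⟨k, hk⟩ := hN V hV
  obtain ⟨q, c, h⟩ := exists_isHoledDiscMorseFunction k
  obtain ⟨e⟩ := hU k V h.FourThickening hk ho h.hasHandleDecomposition_fourThickening
    h.isOrientable_fourThickening
  exact IsSteinDomain.of_diffeomorph e (isSteinDomain_fourThickening h)

/-- **Eliashberg's theorem without `2`-handles (`Gompf1998_thm13_noTwoHandles`) from NORM and
UNIQ₄**: every compact orientable `4`-dimensional `1`-handlebody `W` is a Stein domain — apply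
the connected case to each connected component, an open submanifold of `W` which is a compact
connected orientable `1`-handlebody (`IsOrientable.opens`, `isHandlebodyOfIndexLE_opens`), and
assemble (`isSteinDomain_of_components`, `SteinDomainComponents.lean`). [cite: Gompf1998, Thm. 1.3] -/
theorem Gompf1998_thm13_noTwoHandles_of_norm_uniq
    (hN : exists_hasHandleDecomposition_handleCount_one.{0})
    (hU : nonempty_diffeomorph_of_hasHandleDecomposition_handleCount_one.{0}) :
    Gompf1998_thm13_noTwoHandles := by
  intro W _ _ _ _ _ _ ho hW
  refine isSteinDomain_of_components fun i => ?_
  exact isSteinDomain_of_oneHandlebody_of_norm_uniq hN hU (compOpens W i)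
    (ho.opens (compOpens W i)) (isHandlebodyOfIndexLE_opens (compOpens W i) hW)

/-- **Eliashberg's theorem without `2`-handles from NORM and the handle facts L0, L1** (UNIQ₄ being
`nonempty_diffeomorph_of_hasHandleDecomposition_handleCount_one_of_handles`,
`OneHandlebodyClassification.lean`). [cite: Gompf1998, Thm. 1.3] -/
theorem Gompf1998_thm13_noTwoHandles_of_handles
    (hN : exists_hasHandleDecomposition_handleCount_one.{0})
    (h₀ : zeroHandle_nonempty_diffeomorph_closedBall.{0}) (h₁ : oneHandle_nonempty_diffeomorph.{0}) :
    Gompf1998_thm13_noTwoHandles :=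
  Gompf1998_thm13_noTwoHandles_of_norm_uniq hN
    (nonempty_diffeomorph_of_hasHandleDecomposition_handleCount_one_of_handles h₀ h₁)

/-- **Eliashberg's theorem without `2`-handles from the single handle fact L1.**  NORM is
discharged (`exists_hasHandleDecomposition_handleCount_one_holds`, Milnor's First Cancellation
Theorem, `SPC4HandlesNormHolds.lean`) and UNIQ₄ follows from the uniqueness of attaching one
`1`-handle alone (`nonempty_diffeomorph_of_hasHandleDecomposition_handleCount_one_of_oneHandle`,
the `0`-handle being a disc by the Morse disc lemma, `SPC4HandlesLeaves.lean`); so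
`Gompf1998_thm13_noTwoHandles` follows from L1 `oneHandle_nonempty_diffeomorph` (Kosinski 1993,
VI (6.6), (11.4)(c)) alone. [cite: Gompf1998, Thm. 1.3] [cite: Kosinski1993, VI (6.6), (11.4)(c)] -/
theorem Gompf1998_thm13_noTwoHandles_of_oneHandle (h₁ : oneHandle_nonempty_diffeomorph.{0}) :
    Gompf1998_thm13_noTwoHandles :=
  Gompf1998_thm13_noTwoHandles_of_norm_uniq exists_hasHandleDecomposition_handleCount_one_holds
    (nonempty_diffeomorph_of_hasHandleDecomposition_handleCount_one_of_oneHandle h₁)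

/-- **Eliashberg's theorem without `2`-handles — discharge of the named fact
`Gompf1998_thm13_noTwoHandles`.**  Every compact orientable smooth `4`-manifold with a handle
decomposition without handles of index `≥ 2` (a `1`-handlebody) is a Stein domain: Gompf (1998),
Thm. 1.3 (the case with no `2`-handles, where conditions (b), (c) are vacuous) and §2, ¶1
(`X₁ = ♮ⁿ S¹ × B³` is Stein); Eliashberg (1990); Akbulut–Matveyev (1998), Thm. 2 (1).  Proof:
`Gompf1998_thm13_noTwoHandles_of_oneHandle` (Stein models `{q(x, y) + z² + w² ≤ c}` of
`♮ᵏ (S¹ × B³)`, diffeomorphism invariance, assembly over components, Milnor's normal form NORM and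
the classification UNIQ₄ of orientable `4`-dimensional `1`-handlebodies) applied to the discharge
`oneHandle_nonempty_diffeomorph_holds` of the handle fact L1 (`OneHandleStepExists.lean`;
Milnor 1965, Thm. 3.13; Kosinski 1993, VI (6.4), (7.1)).
[cite: Gompf1998, Thm. 1.3 and §2] [cite: AkbulutMatveyev1998, Thm. 2 (1)] -/
theorem Gompf1998_thm13_noTwoHandles_holds : Gompf1998_thm13_noTwoHandles :=
  Gompf1998_thm13_noTwoHandles_of_oneHandle oneHandle_nonempty_diffeomorph_holds

end Literature.Geometry.Symplectic

end
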